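import Mathlib
import Literature.Analysis.FluidPDE.SelfSimilarEulerProfile
import Literature.Analysis.FluidPDE.SwirlTransportProofs
import Literature.Analysis.FluidPDE.AxisymmetricVorticityTransport
import Literature.Analysis.FluidPDE.SelfSimilarEulerSwirlingFixedPoint
import Literature.Analysis.FluidPDE.AxisymOmegaThetaEnergy
import HarnessLib

/-!
# The SWIRL LAW of axisymmetric self-similar Euler profiles: `(W·∇)Γ = (2γ−1)Γ` — angular momentum grows like `e^{(1−2γ)t}` along
# BACKWARD similarity orbits (target T1 «tangential channels» of THE ONE STATEMENT, crux `EulerZoomLiouville.PowerGaugeEulerLiouville` =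
# stmt-NavierStokesRegularity-19832, line `birth`; RESIDUE-MEMO-19832-g12 §2)

Route №10 `EulerZoomLiouville` (NavierStokesRegularity); LEAD ns-typeII-p2 g12.  After ROUND-37 (S37) (axisymmetric SWIRL-FREE `C²` profiles are trivial,
`NeedleRace.selfSimilar_ae_eq_zero_of_axisymNoSwirlC2`, ns-ezl-w2 g3 p639100) and the sharp vortical squeeze (only TANGENTIAL or pressurised Bernoulli-high channel
points survive, LEAD p639458), the axisymmetric residue of THE ONE STATEMENT carries SWIRL.  This file records its first dynamical law:

* (the classical pressure of an axisymmetric CIV profile centred on the axis is an axisymmetric scalar — the tree's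
  `IsSelfSimilarEulerProfile.isAxisymmetricScalar_pressure`, `Literature/…/SelfSimilarEulerSwirlingFixedPoint`, CIV §4);
* **`fderiv_swirl_transport`** — the SWIRL LAW: for an axisymmetric CIV profile `(V, P′)` with exponent `γ` and centre `0`,
  `DΓ(y)[γy + V y] = (2γ − 1) Γ(y)`, `Γ = swirl V = y₀V₁ − y₁V₀ = r V_θ` (pair the profile equation with the rotation generator `J y`: `⟪Jy, DV[W]⟫ = DΓ[W] − γΓ`,
  `⟪Jy, ∇P′⟫ = 0`, `⟪J(Vy), Vy⟫ = 0`) — the self-similar form of Kelvin's conservation of `r u_θ` (`D_t(r u_θ) = 0`, KNSS 2009 (1.8)); the pointwise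
  axisymmetric companion of CIV's self-similar Kelvin theorem for loops (`e^{(1−2γ)τ}Γ(τ) = Γ(0)`, tree `SelfSimilarEulerClosedOrbit`);
* `swirl_comp_orbit_eq` — along every similarity orbit `Y′ = γY + V(Y)`: `Γ(Y(t)) = Γ(Y(0)) e^{(2γ−1)t}`; so `Γ` DECAYS forward and GROWS BACKWARD like `e^{(1−2γ)|t|}`
  (`1 − 2γ = ργ` at the class rate `γ = 1/(2+ρ)`);
* `swirl_escape` — hence `|Γ(Y(0))| e^{(1−2γ)(−t)} ≤ ‖Y(t)‖ ‖V(Y(t))‖` for all `t` (`|Γ| ≤ r|V| ≤ ‖y‖‖V y‖`): a backward orbit through a SWIRLING point (`Γ ≠ 0`) of a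
  profile with linear growth `‖V y‖ ≤ K₁(1+‖y‖)` escapes to infinity at least like `e^{ργt/2}` — a RATE OF ESCAPE for free on `{Γ ≠ 0}` (the volume race of the
  (C2) squeeze needs `(3+3ρ)·rate > 3γ`, which `ργ/2` does NOT meet: `ρ(1+ρ) < 2`; RESIDUE-MEMO-19832-g12 §2 T1 records the gap).

HONEST LABEL: PORTRAIT lemmas (no stratum is closed here).  WHAT THIS IS NOT: not NS, not E — structural facts about hypothetical axisymmetric self-similar profiles,
`--supports` stmt-19832 as helper; 19832 OPEN; NS regularity NOT proved. [folklore; KNSS2009 §1 (1.8); ConstantinIgnatovaVicol2026Putative §3.1.1 (3.3), §3.4 (3.19)]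
-/

noncomputable section

-- flat `Theorems/<Route><Decl>…` files of one crux share the namespace of the crux (tree convention)
set_option linter.dupNamespace false

open Set Filter Topology Metric Function InnerProductSpace
open scoped RealInnerProductSpace NNReal ENNReal ContDiff

namespace Summit.NavierStokesRegularity.NavierStokesRegularity.Theorems.PowerGaugeEulerLiouville.SwirlLaw

open Literature.Analysis Literature.Analysis.FluidPDE

variable {γ : ℝ} {V : EuclideanSpace ℝ (Fin 3) → EuclideanSpace ℝ (Fin 3)} {P' : EuclideanSpace ℝ (Fin 3) → ℝ}

/-! ### The swirl law -/

/-- **THE SWIRL LAW `(W·∇)Γ = (2γ−1)Γ`.**  For a CIV profile `(V, P′)` with exponent `γ`, centre `0`, axisymmetric velocity and axisymmetric pressure: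
`DΓ(y)[γ y + V y] = (2γ − 1)·Γ(y)`, `Γ = swirl V` — the self-similar form of `D_t (r u_θ) = 0`. [folklore; KNSS2009 §1 (1.8)] -/
theorem fderiv_swirl_transport
    (hprof : IsSelfSimilarEulerProfile γ 0 V P') (hP : IsAxisymmetricScalar P') (y : EuclideanSpace ℝ (Fin 3)) :
    fderiv ℝ (swirl V) y (γ • y + V y) = (2 * γ - 1) * swirl V y := by
  have hVd : Differentiable ℝ V := hprof.differentiable_velocity
  have hPd : Differentiable ℝ P' := hprof.differentiable_pressure
  have hDV : fderiv ℝ V y (γ • y + V y) = -((1 - γ) • V y) - gradient P' y := by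
    have h := hprof.profile_eq y
    simp only [sub_zero] at h
    -- `(1-γ)V + DV[W] + ∇P = 0`
    calc fderiv ℝ V y (γ • y + V y)
        = ((1 - γ) • V y + fderiv ℝ V y (γ • y + V y) + gradient P' y) - (1 - γ) • V y - gradient P' y := by abel
      _ = 0 - (1 - γ) • V y - gradient P' y := by rw [h]
      _ = -((1 - γ) • V y) - gradient P' y := by abel
  rw [fderiv_swirl_apply (hVd y), hDV, rotGen_add, rotGen_smul, inner_add_left, inner_smul_left,
    inner_rotGen_self, inner_sub_right, inner_neg_right, inner_smul_right, hP.inner_rotGen_gradient (hPd y)]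
  have hΓ : swirl V y = ⟪rotGen y, V y⟫ := by rw [swirl_eq_inner_rotGen]
  rw [hΓ]
  simp only [RCLike.conj_to_real]
  ring

/-- The swirl law for an axisymmetric VELOCITY profile (the pressure symmetry is automatic). [folklore; KNSS2009 §1 (1.8)] -/
theorem fderiv_swirl_transport_of_isAxisymmetric (hprof : IsSelfSimilarEulerProfile γ 0 V P') (hax : IsAxisymmetric V)
    (y : EuclideanSpace ℝ (Fin 3)) : fderiv ℝ (swirl V) y (γ • y + V y) = (2 * γ - 1) * swirl V y :=
  fderiv_swirl_transport hprof (hprof.isAxisymmetricScalar_pressure hax ⟨rfl, rfl⟩) y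

/-! ### Along similarity orbits: exponential law and backward escape -/

/-- **`Γ(Y(t)) = Γ(Y(0))·e^{(2γ−1)t}` along every similarity orbit** `Y′ = γY + V(Y)` (global in time) of an axisymmetric CIV profile. [folklore] -/
theorem swirl_comp_orbit_eq (hprof : IsSelfSimilarEulerProfile γ 0 V P') (hax : IsAxisymmetric V)
    {Y : ℝ → EuclideanSpace ℝ (Fin 3)} (hY : ∀ t, HasDerivAt Y (γ • Y t + V (Y t)) t) (t : ℝ) :
    swirl V (Y t) = swirl V (Y 0) * Real.exp ((2 * γ - 1) * t) := by
  have hVd : Differentiable ℝ V := hprof.differentiable_velocity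
  -- `f = Γ ∘ Y` solves `f' = (2γ−1) f`
  have hf : ∀ s, HasDerivAt (fun s => swirl V (Y s)) ((2 * γ - 1) * swirl V (Y s)) s := by
    intro s
    have h := ((differentiableAt_swirl (hVd (Y s))).hasFDerivAt.comp_hasDerivAt s (hY s))
    rw [fderiv_swirl_transport_of_isAxisymmetric hprof hax] at h
    exact h
  -- `g = f · e^{(1−2γ)s}` is constant
  have hg : ∀ s, HasDerivAt (fun s => swirl V (Y s) * Real.exp ((1 - 2 * γ) * s)) 0 s := by
    intro s
    have he : HasDerivAt (fun s => Real.exp ((1 - 2 * γ) * s)) (Real.exp ((1 - 2 * γ) * s) * ((1 - 2 * γ) * 1)) s :=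
      ((hasDerivAt_id' s).const_mul (1 - 2 * γ)).exp
    have h := (hf s).mul he
    have hzero : (2 * γ - 1) * swirl V (Y s) * Real.exp ((1 - 2 * γ) * s) +
        swirl V (Y s) * (Real.exp ((1 - 2 * γ) * s) * ((1 - 2 * γ) * 1)) = 0 := by ring
    rw [hzero] at h
    exact h
  have hconst := is_const_of_deriv_eq_zero (f := fun s => swirl V (Y s) * Real.exp ((1 - 2 * γ) * s))
    (fun s => (hg s).differentiableAt) (fun s => (hg s).deriv) t 0
  simp only [mul_zero, Real.exp_zero, mul_one] at hconst
  have hexp : Real.exp ((1 - 2 * γ) * t) * Real.exp ((2 * γ - 1) * t) = 1 := by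
    rw [← Real.exp_add]
    have : (1 - 2 * γ) * t + (2 * γ - 1) * t = 0 := by ring
    rw [this, Real.exp_zero]
  calc swirl V (Y t) = swirl V (Y t) * (Real.exp ((1 - 2 * γ) * t) * Real.exp ((2 * γ - 1) * t)) := by rw [hexp, mul_one]
    _ = (swirl V (Y t) * Real.exp ((1 - 2 * γ) * t)) * Real.exp ((2 * γ - 1) * t) := by ring
    _ = swirl V (Y 0) * Real.exp ((2 * γ - 1) * t) := by rw [hconst]

/-- **SWIRL ESCAPE**: along a (global) similarity orbit of an axisymmetric CIV profile, `|Γ(Y(0))| · e^{(1−2γ)(−t)} ≤ ‖Y(t)‖ · ‖V(Y(t))‖` for every `t`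
(interesting for `t < 0`): backward orbits through SWIRLING points leave every ball at least like `e^{(1−2γ)|t|}` in the product `‖Y‖‖V(Y)‖`. [folklore] -/
theorem swirl_escape (hprof : IsSelfSimilarEulerProfile γ 0 V P') (hax : IsAxisymmetric V)
    {Y : ℝ → EuclideanSpace ℝ (Fin 3)} (hY : ∀ t, HasDerivAt Y (γ • Y t + V (Y t)) t) (t : ℝ) :
    |swirl V (Y 0)| * Real.exp ((1 - 2 * γ) * (-t)) ≤ ‖Y t‖ * ‖V (Y t)‖ := by
  have h := swirl_comp_orbit_eq hprof hax hY t
  have hcyl : cylRadius (Y t) ≤ ‖Y t‖ := by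
    refine (pow_le_pow_iff_left₀ (cylRadius_nonneg _) (norm_nonneg _) two_ne_zero).1 ?_
    rw [cylRadius_sq, EuclideanSpace.norm_eq, Real.sq_sqrt (Finset.sum_nonneg fun i _ => sq_nonneg _), Fin.sum_univ_three]
    simp only [Real.norm_eq_abs, sq_abs]
    nlinarith [sq_nonneg (Y t 2)]
  have h1 : |swirl V (Y t)| ≤ ‖Y t‖ * ‖V (Y t)‖ :=
    (abs_swirl_le_cylRadius_mul V (Y t)).trans (mul_le_mul_of_nonneg_right hcyl (norm_nonneg _))
  have h2 : |swirl V (Y t)| = |swirl V (Y 0)| * Real.exp ((2 * γ - 1) * t) := by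
    rw [h, abs_mul, Real.abs_exp]
  have h3 : |swirl V (Y 0)| * Real.exp ((1 - 2 * γ) * (-t)) = |swirl V (Y 0)| * Real.exp ((2 * γ - 1) * t) := by
    have : (1 - 2 * γ) * (-t) = (2 * γ - 1) * t := by ring
    rw [this]
  rw [h3, ← h2]
  exact h1

/-- **SWIRL ESCAPE UNDER LINEAR GROWTH**: if moreover `‖V y‖ ≤ K₁(1+‖y‖)`, then `|Γ(Y(0))| e^{(1−2γ)(−t)} ≤ K₁ ‖Y(t)‖ (1 + ‖Y(t)‖)` for every `t` — a backward orbit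
through a point with `Γ ≠ 0` has `‖Y(t)‖ → ∞` at least like `e^{(1−2γ)|t|/2}` as `t → −∞`. [folklore] -/
theorem swirl_escape_of_linearGrowth (hprof : IsSelfSimilarEulerProfile γ 0 V P') (hax : IsAxisymmetric V)
    {K₁ : ℝ} (hK₁ : ∀ y : EuclideanSpace ℝ (Fin 3), ‖V y‖ ≤ K₁ * (1 + ‖y‖))
    {Y : ℝ → EuclideanSpace ℝ (Fin 3)} (hY : ∀ t, HasDerivAt Y (γ • Y t + V (Y t)) t) (t : ℝ) :
    |swirl V (Y 0)| * Real.exp ((1 - 2 * γ) * (-t)) ≤ K₁ * ‖Y t‖ * (1 + ‖Y t‖) := by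
  refine (swirl_escape hprof hax hY t).trans ?_
  calc ‖Y t‖ * ‖V (Y t)‖ ≤ ‖Y t‖ * (K₁ * (1 + ‖Y t‖)) := mul_le_mul_of_nonneg_left (hK₁ _) (norm_nonneg _)
    _ = K₁ * ‖Y t‖ * (1 + ‖Y t‖) := by ring

end Summit.NavierStokesRegularity.NavierStokesRegularity.Theorems.PowerGaugeEulerLiouville.SwirlLaw

end
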